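import Summits.QuantumFields.GaugeBoot.DiagonalRPTorusColumns
import HarnessLib

/-!
# Line cuts on `(ℤ/L)³`: `4L` plaquettes between well-separated columns
(gauge-boot, task L3(ν), companion 1/2)

HONEST FRAMING (cell `pub-gaugeboot`, page 1 of every file): the venture produces certified bounds
on lattice expectations at stated coupling, gauge group, dimension and torus size; NOT a mass gap,
NOT a continuum limit, NOT a string tension; NOT Yang–Mills-summit-bearing (barriers
`FixedCouplingUltralocality`, `PerturbativeInvisibility`). This module is geometric bookkeeping
for the structural NEGATIVE result `DiagonalRPTorusInnerHalfNegativeEven`; it discharges nothing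
by itself.

## Content (general torus size `L`, dimension `3`, spectator direction `2`)

`DiagonalRPTorusColumns.two_mul_le_card` bounds the size of a plaquette set spanning two columns
`A`, `B` of `(ℤ/L)²` by `2L` through one-link cuts. Here a second family of cuts is used, the
LINE CUTS `lineCut j h z` = all vertical links at height `z` over the columns `W` with `W_j = h`
(`j ∈ {0, 1}`): such a cut meets the column `C` in one link if `C_j = h` and not at all otherwise
(`sum_ccnt_lineCut_self`, `sum_ccnt_lineCut_eq_zero`), and a plaquette crosses it an odd number
of times only if it is a vertical plaquette of the plane `(j, 2)` at height `z` whose two columns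
straddle the line (`odd_sum_pcnt_lineCut`). With the four lines through `A` and `B`
(`j = 0, 1`), at every height, **`four_mul_le_card`**: if `A_j - B_j ∉ {0, 1, -1}` for `j = 0, 1`,
every plaquette set with boundary `column A + column B` has at least `4L` plaquettes
(`DiagRPThree.card_le_of_cuts`).

Elementary; not in print as far as the cell's searches go.
-/

open MeasureTheory Complex Finset
open scoped ComplexOrder

namespace Summit.QuantumFields.GaugeBoot

open Literature.MathematicalPhysics.QuantumFieldTheory

namespace DiagRPThree

section LineCuts

variable {L : ℕ} [NeZero L]

omit [NeZero L] in
/-- **Links of a plaquette inside a link set**: `Σ_{e ∈ N} pcnt p e` counts the four defining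
links of `p` lying in `N`. -/
theorem sum_pcnt_eq (N : Finset (Edge 3 L)) (p : Plaquette 3 L) :
    ∑ e ∈ N, pcnt p e =
      (if (p.1, p.2.1.1) ∈ N then 1 else 0) + (if (p.1.shift p.2.1.1, p.2.1.2) ∈ N then 1 else 0) +
      (if (p.1.shift p.2.1.2, p.2.1.1) ∈ N then 1 else 0) + (if (p.1, p.2.1.2) ∈ N then 1 else 0) := by
  unfold pcnt
  rw [sum_add_distrib, sum_add_distrib, sum_add_distrib, sum_ite_eq, sum_ite_eq, sum_ite_eq,
    sum_ite_eq]

/-- The LINE CUT: vertical links at height `z` over the columns `W` with `W_j = h`. -/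
def lineCut (j : Fin 3) (h z : ZMod L) : Finset (Edge 3 L) :=
  univ.filter fun e => e.2 = 2 ∧ e.1 2 = z ∧ e.1 j = h

/-- Membership in a line cut. -/
theorem mem_lineCut {j : Fin 3} {h z : ZMod L} {e : Edge 3 L} :
    e ∈ lineCut j h z ↔ e.2 = 2 ∧ e.1 2 = z ∧ e.1 j = h := by
  simp [lineCut]

/-- The first direction of a coordinate plane is horizontal (`≠ 2`). -/
theorem plane_fst_ne_two (pl : {q : Fin 3 × Fin 3 // q.1 < q.2}) : pl.1.1 ≠ 2 := fun h2 => by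
  have h' := pl.2
  rw [h2] at h'
  exact absurd h' (not_lt.2 (Fin.le_last _))

/-- **Crossing a line cut.** If a plaquette crosses `lineCut j h z` an odd number of times, then it
is a vertical plaquette of the plane `(j, 2)` at height `z` and the line passes through one of its
two columns: `h = x_j` or `h = x_j + 1` (`x` its base point). -/
theorem odd_sum_pcnt_lineCut {j : Fin 3} {h z : ZMod L} {p : Plaquette 3 L}
    (hodd : Odd (∑ e ∈ lineCut j h z, pcnt p e)) :
    p.2.1.2 = 2 ∧ p.1 2 = z ∧ p.2.1.1 = j ∧ (h = p.1 j ∨ h = p.1 j + 1) := by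
  have hi := plane_fst_ne_two p.2
  rw [sum_pcnt_eq] at hodd
  have h1 : (p.1, p.2.1.1) ∉ lineCut j h z := fun hm => hi (mem_lineCut.1 hm).1
  have h3 : (p.1.shift p.2.1.2, p.2.1.1) ∉ lineCut j h z := fun hm => hi (mem_lineCut.1 hm).1
  rw [if_neg h1, if_neg h3, zero_add, add_zero] at hodd
  -- both remaining links must not have the same status
  by_cases h2 : (p.1.shift p.2.1.1, p.2.1.2) ∈ lineCut j h z <;>
    by_cases h4 : (p.1, p.2.1.2) ∈ lineCut j h z <;>
    simp only [h2, h4, if_true, if_false] at hodd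
  · exact absurd hodd (by decide)
  · obtain ⟨hpl, hz, hh⟩ := mem_lineCut.1 h2
    simp only at hpl hz hh
    rw [WilsonRP.shift_apply_of_ne _ hi.symm] at hz
    by_cases hji : j = p.2.1.1
    · refine ⟨hpl, hz, hji.symm, Or.inr ?_⟩
      rw [← hh, hji, WilsonRP.shift_apply_self]
    · -- the line is parallel to the plaquette: both columns have the same `j`-coordinate
      rw [WilsonRP.shift_apply_of_ne _ hji] at hh
      exact absurd (mem_lineCut.2 ⟨hpl, by simpa [WilsonRP.shift_apply_of_ne _ hi.symm] using hz,
        hh⟩) h4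
  · obtain ⟨hpl, hz, hh⟩ := mem_lineCut.1 h4
    simp only at hpl hz hh
    by_cases hji : j = p.2.1.1
    · exact ⟨hpl, hz, hji.symm, Or.inl hh.symm⟩
    · refine absurd (mem_lineCut.2 ⟨hpl, ?_, ?_⟩) h2
      · simpa [WilsonRP.shift_apply_of_ne _ hi.symm] using hz
      · simpa [WilsonRP.shift_apply_of_ne _ hji] using hh
  · exact absurd hodd (by decide)

/-- The `j`-coordinate of a column, `j ∈ {0, 1}` (`j = 2`: unused, value `0`). -/
def coordOf (C : ZMod L × ZMod L) (j : Fin 3) : ZMod L := vsite C 0 j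

/-- A column link inside a line cut is the link of that column at the cut's height, and the line
passes through the column. -/
theorem eq_of_mem_lineCut_of_ccnt_ne_zero {C : ZMod L × ZMod L} {j : Fin 3} (hj : j = 0 ∨ j = 1)
    {h z : ZMod L} {e : Edge 3 L} (he : e ∈ lineCut j h z) (hc : ccnt C e ≠ 0) :
    e = (vsite C z, (2 : Fin 3)) ∧ coordOf C j = h := by
  obtain ⟨h2, hz, hh⟩ := mem_lineCut.1 he
  obtain ⟨-, h0, h1⟩ := ccnt_ne_zero hc
  refine ⟨Prod.ext (eq_vsite_iff.2 ⟨⟨h0, h1⟩, hz⟩) h2, ?_⟩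
  unfold coordOf
  rcases hj with rfl | rfl
  · rw [vsite_zero, ← h0, hh]
  · rw [vsite_one, ← h1, hh]

/-- The line through `C` meets the column `C` in exactly its link at height `z`. -/
theorem sum_ccnt_lineCut_self (C : ZMod L × ZMod L) {j : Fin 3} (hj : j = 0 ∨ j = 1) (z : ZMod L) :
    ∑ e ∈ lineCut j (coordOf C j) z, ccnt C e = 1 := by
  have hmem : ((vsite C z, (2 : Fin 3)) : Edge 3 L) ∈ lineCut j (coordOf C j) z := by
    refine mem_lineCut.2 ⟨rfl, rfl, ?_⟩
    unfold coordOf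
    rcases hj with rfl | rfl <;> rfl
  rw [sum_eq_single_of_mem _ hmem fun e he hne => ?_]
  · unfold ccnt
    exact if_pos ⟨rfl, rfl, rfl⟩
  · by_contra hc
    exact hne (eq_of_mem_lineCut_of_ccnt_ne_zero hj he hc).1

/-- A line NOT through `C` misses the column `C`. -/
theorem sum_ccnt_lineCut_eq_zero (C : ZMod L × ZMod L) {j : Fin 3} (hj : j = 0 ∨ j = 1)
    {h : ZMod L} (hC : coordOf C j ≠ h) (z : ZMod L) :
    ∑ e ∈ lineCut j h z, ccnt C e = 0 := by
  refine sum_eq_zero fun e he => ?_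
  by_contra hc
  exact hC (eq_of_mem_lineCut_of_ccnt_ne_zero hj he hc).2

/-- **`4L` line cuts.** If the columns `A`, `B` satisfy `A_j - B_j ∉ {0, 1, -1}` for `j = 0, 1`,
every plaquette set with boundary `column A + column B` has at least `4L` plaquettes: the lines
through `A` and through `B` in both horizontal directions, at every height, are `4L` cuts each
separating the columns, and no plaquette crosses two of them an odd number of times. -/
theorem four_mul_le_card {A B : ZMod L × ZMod L}
    (hsep : ∀ j : Fin 3, j = 0 ∨ j = 1 → coordOf A j ≠ coordOf B j ∧
      coordOf A j ≠ coordOf B j + 1 ∧ coordOf A j + 1 ≠ coordOf B j)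
    {S : Finset (Plaquette 3 L)} (hS : ∀ e, Even (degS S e + ccnt A e + ccnt B e)) :
    4 * L ≤ S.card := by
  -- cuts indexed by (direction j ∈ {0,1}, which column, height)
  let K : Finset (Fin 3 × Bool × ZMod L) := ({0, 1} : Finset (Fin 3)) ×ˢ (univ ×ˢ univ)
  let W : Fin 3 × Bool × ZMod L → Finset (Edge 3 L) :=
    fun κ => lineCut κ.1 (coordOf (if κ.2.1 then A else B) κ.1) κ.2.2
  have hK : ∀ κ ∈ K, κ.1 = 0 ∨ κ.1 = 1 := by
    intro κ hκ
    have := (mem_product.1 hκ).1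
    simpa using this
  have hcard : K.card = 4 * L := by
    simp only [K, card_product, card_univ, Fintype.card_bool, ZMod.card]
    rw [card_insert_of_notMem (by decide), card_singleton]
    ring
  rw [← hcard]
  refine card_le_of_cuts K W ?_ ?_ hS
  · -- each cut separates the columns
    intro κ hκ
    have hj := hK κ hκ
    obtain ⟨j, b, z⟩ := κ
    simp only at hj
    show Odd (∑ e ∈ lineCut j (coordOf (if b = true then A else B) j) z, (ccnt A e + ccnt B e))
    rw [sum_add_distrib]
    cases b
    · simp only [Bool.false_eq_true, if_false]
      rw [sum_ccnt_lineCut_eq_zero A hj (hsep j hj).1 z, sum_ccnt_lineCut_self B hj z]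
      exact odd_one
    · simp only [if_true]
      rw [sum_ccnt_lineCut_self A hj z, sum_ccnt_lineCut_eq_zero B hj (hsep j hj).1.symm z]
      exact odd_one
  · -- no plaquette crosses two cuts oddly
    intro p
    refine card_le_one.2 fun κ₁ hκ₁ κ₂ hκ₂ => ?_
    obtain ⟨hκ₁K, hκ₁odd⟩ := mem_filter.1 hκ₁
    obtain ⟨hκ₂K, hκ₂odd⟩ := mem_filter.1 hκ₂
    have hj₁ := hK κ₁ hκ₁K
    have hj₂ := hK κ₂ hκ₂K
    obtain ⟨j₁, b₁, z₁⟩ := κ₁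
    obtain ⟨j₂, b₂, z₂⟩ := κ₂
    simp only at hj₁ hj₂ hκ₁odd hκ₂odd
    obtain ⟨-, hz₁, hji₁, hh₁⟩ := odd_sum_pcnt_lineCut hκ₁odd
    obtain ⟨-, hz₂, hji₂, hh₂⟩ := odd_sum_pcnt_lineCut hκ₂odd
    have hj : j₁ = j₂ := hji₁.symm.trans hji₂
    have hz : z₁ = z₂ := hz₁.symm.trans hz₂
    subst hj hz
    -- the two lines through `A` and `B` in direction `j₁` cannot both pass a column of `p`
    suffices hb : b₁ = b₂ by rw [hb]
    by_contra hb
    obtain ⟨hs0, hs1, hs2⟩ := hsep j₁ hj₁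
    have key : ∀ {a c : ZMod L}, (a = p.1 j₁ ∨ a = p.1 j₁ + 1) → (c = p.1 j₁ ∨ c = p.1 j₁ + 1) →
        a ≠ c → a ≠ c + 1 → a + 1 ≠ c → False := by
      rintro a c (rfl | rfl) (rfl | rfl) h0 hp hm
      · exact h0 rfl
      · exact hm rfl
      · exact hp rfl
      · exact h0 rfl
    cases b₁ <;> cases b₂
    · exact hb rfl
    · simp only [Bool.false_eq_true, if_false, if_true] at hh₁ hh₂
      exact key hh₂ hh₁ hs0 hs1 hs2
    · simp only [Bool.false_eq_true, if_false, if_true] at hh₁ hh₂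
      exact key hh₁ hh₂ hs0 hs1 hs2
    · exact hb rfl

end LineCuts

end DiagRPThree

end Summit.QuantumFields.GaugeBoot
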